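import Mathlib.Analysis.SpecialFunctions.Gamma.Beta
import Mathlib.MeasureTheory.Integral.IntegralEqImproper
import HarnessLib

/-!
# The lemniscatic period integral `∫₁^∞ du/√(u³ − u) = Γ(1/4)²/(2√(2π))`

Topic `Literature/Analysis/SpecialFunctions`. The classical evaluation, via Euler's Beta function,
of the complete elliptic integral attached to the lemniscatic curve `y² = x³ − x`:

  `∫₁^∞ du/√(u³ − u) = ½ B(1/4, 1/2) = Γ(1/4)Γ(1/2)/(2Γ(3/4)) = Γ(1/4)²/(2√(2π))`

(substitute `y = u⁻²`, then use `Γ(1/2) = √π` and the reflection formula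
`Γ(1/4)Γ(3/4) = π/sin(π/4) = π√2`). Twice this number, `ϖ = Γ(1/4)²/√(2π) = 5.2441…`, is the real
period of `y² = x³ − x`; `ϖ/2 = 2.6220…` is Gauss's lemniscate constant. This is the input
"`2∫₁^∞ x^{-1/2}(x²−1)^{-1/2} dx = Γ(1/4)²/(2π)^{1/2}`" of the computation of the values of the
Eisenstein series at `τ = i` (`E₄(i) = 3Γ(1/4)⁸/(2π)⁶`, Hurwitz), used for Nesterenko's corollary
on `π, e^π, Γ(1/4)` (Nesterenko–Philippon, LNM 1752, Ch. 1 §3 Remark ii and Ch. 3 Corollary 1.2);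
see `Literature/NumberTheory/EllipticCurves/EisensteinValuesAtI.lean`.

## Main statements (all proved, no new definitions)

* `integral_rpow_neg_three_quarters_mul_rpow_neg_half`: the real Beta integral
  `∫₀¹ x^{-3/4}(1 − x)^{-1/2} dx = Γ(1/4)Γ(1/2)/Γ(3/4)` (from Mathlib's
  `Complex.betaIntegral_eq_Gamma_mul_div`).
* `Gamma_quarter_mul_Gamma_half_div_Gamma_three_quarters`: `Γ(1/4)Γ(1/2)/Γ(3/4) = Γ(1/4)²/√(2π)`.
* `integral_Ioi_one_inv_sqrt_cube_sub_self`: `∫₁^∞ du/√(u³ − u) = Γ(1/4)²/(2√(2π))`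
  (Mathlib's `MeasureTheory.integral_comp_rpow_Ioi` with `p = −2`).

## References

* Yu. V. Nesterenko, P. Philippon (eds.), *Introduction to Algebraic Independence Theory*,
  LNM 1752, Springer 2001, Ch. 1 (D. Bertrand) §3 Remark ii (PDF p. 19).
* E. T. Whittaker, G. N. Watson, *A Course of Modern Analysis*, §12.41 (Beta function), §22.8
  (lemniscate functions).
-/

noncomputable section

open Real MeasureTheory Set

namespace Literature.Analysis.SpecialFunctions

/-- **Euler's Beta integral at `(1/4, 1/2)`** (real form of Mathlib's `Complex.betaIntegral`):
`∫₀¹ x^{-3/4} (1 − x)^{-1/2} dx = B(1/4, 1/2) = Γ(1/4)Γ(1/2)/Γ(3/4)`. [folklore] -/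
theorem integral_rpow_neg_three_quarters_mul_rpow_neg_half :
    ∫ x in (0 : ℝ)..1, x ^ (-(3 / 4 : ℝ)) * (1 - x) ^ (-(1 / 2 : ℝ)) =
      Real.Gamma (1 / 4) * Real.Gamma (1 / 2) / Real.Gamma (3 / 4) := by
  have hB := Complex.betaIntegral_eq_Gamma_mul_div (1 / 4 : ℂ) (1 / 2 : ℂ) (by norm_num)
    (by norm_num)
  have hlhs : Complex.betaIntegral (1 / 4 : ℂ) (1 / 2 : ℂ) =
      ((∫ x in (0 : ℝ)..1, x ^ (-(3 / 4 : ℝ)) * (1 - x) ^ (-(1 / 2 : ℝ)) : ℝ) : ℂ) := by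
    unfold Complex.betaIntegral
    rw [← intervalIntegral.integral_ofReal]
    refine intervalIntegral.integral_congr (fun x hx => ?_)
    rw [uIcc_of_le zero_le_one] at hx
    have h1 : (x : ℂ) ^ ((1 / 4 : ℂ) - 1) = ((x ^ (-(3 / 4 : ℝ)) : ℝ) : ℂ) := by
      rw [Complex.ofReal_cpow hx.1]; push_cast; ring_nf
    have h2 : (1 - (x : ℂ)) ^ ((1 / 2 : ℂ) - 1) = (((1 - x) ^ (-(1 / 2 : ℝ)) : ℝ) : ℂ) := by
      rw [Complex.ofReal_cpow (by linarith [hx.2])]; push_cast; ring_nf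
    simp only [h1, h2]
    push_cast
    ring
  rw [hlhs] at hB
  have hrhs : Complex.Gamma (1 / 4 : ℂ) * Complex.Gamma (1 / 2 : ℂ) /
      Complex.Gamma ((1 / 4 : ℂ) + 1 / 2) =
      ((Real.Gamma (1 / 4) * Real.Gamma (1 / 2) / Real.Gamma (3 / 4) : ℝ) : ℂ) := by
    rw [show (1 / 4 : ℂ) + 1 / 2 = ((3 / 4 : ℝ) : ℂ) by push_cast; ring,
      show (1 / 4 : ℂ) = ((1 / 4 : ℝ) : ℂ) by push_cast; ring,
      show (1 / 2 : ℂ) = ((1 / 2 : ℝ) : ℂ) by push_cast; ring,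
      Complex.Gamma_ofReal, Complex.Gamma_ofReal, Complex.Gamma_ofReal]
    push_cast
    ring
  rw [hrhs] at hB
  exact_mod_cast hB

/-- `Γ(1/4)Γ(1/2)/Γ(3/4) = Γ(1/4)²/√(2π)` (reflection formula `Γ(1/4)Γ(3/4) = π/sin(π/4) = π√2`
and `Γ(1/2) = √π`). [folklore] -/
theorem Gamma_quarter_mul_Gamma_half_div_Gamma_three_quarters :
    Real.Gamma (1 / 4) * Real.Gamma (1 / 2) / Real.Gamma (3 / 4) =
      Real.Gamma (1 / 4) ^ 2 / Real.sqrt (2 * π) := by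
  have hrefl := Real.Gamma_mul_Gamma_one_sub (1 / 4 : ℝ)
  rw [show (1 : ℝ) - 1 / 4 = 3 / 4 by norm_num, show π * (1 / 4 : ℝ) = π / 4 by ring,
    Real.sin_pi_div_four] at hrefl
  have h34 : Real.Gamma (3 / 4) ≠ 0 := (Real.Gamma_pos_of_pos (by norm_num)).ne'
  have h14 : Real.Gamma (1 / 4) ≠ 0 := (Real.Gamma_pos_of_pos (by norm_num)).ne'
  have hs2 : Real.sqrt 2 ≠ 0 := by positivity
  have hsπ : Real.sqrt π ≠ 0 := by positivity
  rw [Real.Gamma_one_half_eq, Real.sqrt_mul' _ Real.pi_pos.le]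
  -- `Γ(3/4) = π√2/2 / Γ(1/4)`... solve for it
  have h34eq : Real.Gamma (3 / 4) = π / (Real.sqrt 2 / 2) / Real.Gamma (1 / 4) := by
    rw [← hrefl]; field_simp
  rw [h34eq]
  have hππ : Real.sqrt π ^ 2 = π := Real.sq_sqrt Real.pi_pos.le
  have h22 : Real.sqrt 2 ^ 2 = 2 := Real.sq_sqrt (by norm_num : (0:ℝ) ≤ 2)
  field_simp
  linear_combination (Real.sqrt 2 ^ 2) * hππ + π * h22

/-- Pointwise identity behind the substitution `y = x⁻²` in the lemniscatic integral: for `x > 1`,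
`2x⁻³ · (x⁻²)^{-3/4} (1 − x⁻²)^{-1/2} = 2/√(x³ − x)`. [folklore] -/
theorem lemniscate_subst_identity {x : ℝ} (hx : 1 < x) :
    2 * x ^ (-3 : ℝ) * ((x ^ (-2 : ℝ)) ^ (-(3 / 4 : ℝ)) * (1 - x ^ (-2 : ℝ)) ^ (-(1 / 2 : ℝ))) =
      2 * (Real.sqrt (x ^ 3 - x))⁻¹ := by
  have hx0 : 0 < x := by linarith
  have hb : 0 < x ^ 2 - 1 := by nlinarith
  -- rewrite everything as real powers of `x` and of `b = x² − 1`
  have e1 : (x ^ (-2 : ℝ)) ^ (-(3 / 4 : ℝ)) = x ^ (3 / 2 : ℝ) := by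
    rw [← Real.rpow_mul hx0.le]; norm_num
  have e2 : 1 - x ^ (-2 : ℝ) = (x ^ 2 - 1) * x ^ (-2 : ℝ) := by
    rw [Real.rpow_neg hx0.le, Real.rpow_two]
    field_simp
  have e3 : ((x ^ 2 - 1) * x ^ (-2 : ℝ)) ^ (-(1 / 2 : ℝ)) =
      (x ^ 2 - 1) ^ (-(1 / 2 : ℝ)) * x := by
    rw [Real.mul_rpow hb.le (Real.rpow_nonneg hx0.le _), ← Real.rpow_mul hx0.le]
    norm_num
  have e4 : (Real.sqrt (x ^ 3 - x))⁻¹ = x ^ (-(1 / 2 : ℝ)) * (x ^ 2 - 1) ^ (-(1 / 2 : ℝ)) := by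
    rw [show x ^ 3 - x = x * (x ^ 2 - 1) by ring, Real.sqrt_eq_rpow,
      Real.mul_rpow hx0.le hb.le, mul_inv, Real.rpow_neg hx0.le, Real.rpow_neg hb.le]
  rw [e1, e2, e3, e4]
  -- collect the powers of `x`
  have e5 : x ^ (-3 : ℝ) * (x ^ (3 / 2 : ℝ) * x) = x ^ (-(1 / 2 : ℝ)) := by
    rw [show x ^ (3 / 2 : ℝ) * x = x ^ (5 / 2 : ℝ) by
      rw [show (5 / 2 : ℝ) = 3 / 2 + 1 by norm_num, Real.rpow_add hx0, Real.rpow_one],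
      ← Real.rpow_add hx0]
    norm_num
  calc 2 * x ^ (-3 : ℝ) * (x ^ (3 / 2 : ℝ) * ((x ^ 2 - 1) ^ (-(1 / 2 : ℝ)) * x))
      = 2 * (x ^ (-3 : ℝ) * (x ^ (3 / 2 : ℝ) * x)) * (x ^ 2 - 1) ^ (-(1 / 2 : ℝ)) := by ring
    _ = 2 * (x ^ (-(1 / 2 : ℝ)) * (x ^ 2 - 1) ^ (-(1 / 2 : ℝ))) := by rw [e5]; ring

/-- **The lemniscatic period integral** (Euler; LNM 1752 Ch. 1 §3 Remark ii:
"`2∫₁^∞ x^{-1/2}(x²−1)^{-1/2} dx = Γ(1/4)²/(2π)^{1/2}`"): `∫₁^∞ du/√(u³ − u) = Γ(1/4)²/(2√(2π))`,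
by the substitution `y = u⁻²` reducing it to `½ B(1/4, 1/2)`.
[cite: NesterenkoPhilippon2001, Ch. 1 §3 Remark ii (PDF p. 19)] -/
theorem integral_Ioi_one_inv_sqrt_cube_sub_self :
    ∫ u in Ioi (1 : ℝ), (Real.sqrt (u ^ 3 - u))⁻¹ = Real.Gamma (1 / 4) ^ 2 / (2 * Real.sqrt (2 * π)) := by
  set h : ℝ → ℝ := fun y => y ^ (-(3 / 4 : ℝ)) * (1 - y) ^ (-(1 / 2 : ℝ)) with hh
  have key := integral_comp_rpow_Ioi (indicator (Ioo 0 1) h) (p := -2) (by norm_num)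
  -- the right-hand side is the Beta integral
  rw [setIntegral_indicator measurableSet_Ioo,
    show Ioi (0 : ℝ) ∩ Ioo 0 1 = Ioo 0 1 from
      inter_eq_right.mpr Ioo_subset_Ioi_self,
    ← integral_Ioc_eq_integral_Ioo, ← intervalIntegral.integral_of_le zero_le_one] at key
  have hbeta : ∫ y in (0 : ℝ)..1, h y = Real.Gamma (1 / 4) ^ 2 / Real.sqrt (2 * π) := by
    simp only [hh]
    rw [integral_rpow_neg_three_quarters_mul_rpow_neg_half,
      Gamma_quarter_mul_Gamma_half_div_Gamma_three_quarters]
  rw [hbeta] at key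
  -- the left-hand side is `2 ∫₁^∞ du/√(u³ − u)`
  have hL : EqOn (fun x : ℝ => (|(-2 : ℝ)| * x ^ ((-2 : ℝ) - 1)) • indicator (Ioo 0 1) h (x ^ (-2 : ℝ)))
      (indicator (Ioi 1) fun x => 2 * (Real.sqrt (x ^ 3 - x))⁻¹) (Ioi 0) := by
    intro x hx
    have hx0 : 0 < x := hx
    simp only
    by_cases h1 : 1 < x
    · have hmem : x ^ (-2 : ℝ) ∈ Ioo (0 : ℝ) 1 := by
        refine ⟨Real.rpow_pos_of_pos hx0 _, ?_⟩
        rw [Real.rpow_neg hx0.le, Real.rpow_two]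
        exact inv_lt_one_of_one_lt₀ (by nlinarith)
      rw [indicator_of_mem hmem, indicator_of_mem (show x ∈ Ioi (1 : ℝ) from h1), smul_eq_mul,
        show |(-2 : ℝ)| = 2 by norm_num, show (-2 : ℝ) - 1 = -3 by norm_num, hh]
      exact lemniscate_subst_identity h1
    · have hnot : x ^ (-2 : ℝ) ∉ Ioo (0 : ℝ) 1 := by
        rintro ⟨-, hlt⟩
        rw [Real.rpow_neg hx0.le, Real.rpow_two] at hlt
        have hx1 : x ≤ 1 := not_lt.mp h1
        have : 1 ≤ (x ^ 2)⁻¹ := one_le_inv₀ (by positivity) |>.mpr (by nlinarith)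
        linarith
      rw [indicator_of_notMem hnot, indicator_of_notMem (show x ∉ Ioi (1 : ℝ) from h1), smul_zero]
  rw [setIntegral_congr_fun measurableSet_Ioi hL, setIntegral_indicator measurableSet_Ioi,
    show Ioi (0 : ℝ) ∩ Ioi 1 = Ioi 1 from inter_eq_right.mpr (Ioi_subset_Ioi zero_le_one),
    integral_const_mul] at key
  have hs : Real.sqrt (2 * π) ≠ 0 := by positivity
  field_simp at key ⊢
  linarith

end Literature.Analysis.SpecialFunctions

end
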